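import Mathlib
import HarnessLib
import HarnessLib.Audit
import Summits.ValiantsHypothesis.ValiantsHypothesis.Theorems.SymmetryDialWalsh

/-!
# SymmetryDial — bent functions on `𝔽₂^d` and the typed targets (B), (I′)

Route `SymmetryDial` (workshop `decomp-valiant`, lens 1, gen 8), item 23711 (P′ = `AffinePebblePairs`);
companion of `Theorems/SymmetryDialWalsh.lean` (Walsh–Hadamard API).  Contents:

* §1 BENT functions (`IsBent`: `d` even and `W_f(ξ)² = 2^d` for all `ξ`): the weight identity
  `(2^d − 2·wt f)² = 2^d`, the hyperplane-count identity `(2·wt f − 4·kerCount f ξ)² = 2^d` for `ξ ≠ 0`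
  (census (c1)), the DUAL sign function (`IsBent.exists_dual`: `W_f = 2^{d/2}·(−1)^{f̃}`), flat spectrum
  ⇒ the common value is `2^d`, and a computed sanity instance (the inner product on `𝔽₂²` is bent);
* §2 the counting lemmas of the kernel plan for (B) (NODE-g8 §5(a) (c2), (c4), (c5)): vanishing
  autocorrelation / BALANCED DERIVATIVES of bent functions, the duality `f ↦ f̃` (`W_{f̃} = 2^{d/2}(−1)^f`,
  `f̃` bent) and its EXCHANGE of the two `C³`-invariants `(wt, value at 0)`;
* §3 the typed targets of the critic's menu (CLEARED 03:51:31Z / 04:14:45Z, g9 priority 1):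
  (B) `BentCThreeBlind` («bent ⇒ C³-blind») and the no-go conjecture (I′) `CFourDecidesGLOnBent`, tagged
  `@[conjecture]`, with `GLEquiv`; only sanity facts are proved about them here.

Nothing here bears on VP ≠ VNP (LADDER-Valiant rung 0); instrument-side infrastructure for P′.
References: MacWilliams–Sloane ch. 14; Rothaus 1976; Dillon 1974; NODE-g8 §5(a) of the workshop lineage.
-/

namespace Summit.ValiantsHypothesis.ValiantsHypothesis.Theorems.SymmetryDialBent

open Finset
open SymmetryDialAffinePebble (V pair AffinePebbleEquiv affinePebbleEquiv_refl affinePebbleEquiv_mono)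
open SymmetryDialAffinePebbleThree (grpMat kerCount kerCount_of_pebbleEquiv_three)
open SymmetryDialPerCongruence (two_nsmul_eq_zero)
open SymmetryDialTranslationOrbits (card_V)
open SymmetryDialWalsh (chi sgn walsh wt chi_comm sum_chi_left sgn_mul_self walsh_zero walsh_eq_kerCount
  sum_walsh_sq sum_walsh_chi sum_walsh_sq_chi wt_eq_of_pebbleEquiv_three)

variable {d : ℕ}

/-! ### 1. Bent functions -/

/-- `f` is BENT: `d` is even and every Walsh coefficient has square `2^d`. -/
def IsBent (f : V d → Bool) : Prop :=
  Even d ∧ ∀ ξ, walsh f ξ ^ 2 = 2 ^ d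

/-- Weight identity of a bent function: `(2^d − 2·wt f)² = 2^d`, i.e. `wt f = 2^{d−1} ± 2^{d/2−1}`. -/
theorem IsBent.wt_sq {f : V d → Bool} (h : IsBent f) :
    ((2 : ℤ) ^ d - 2 * (wt f : ℤ)) ^ 2 = 2 ^ d := by
  rw [← walsh_zero]; exact h.2 0

/-- Hyperplane-count identity of a bent function (census (c1)): for `ξ ≠ 0`,
`(2·wt f − 4·#(supp f ∩ ξ^⊥))² = 2^d`. -/
theorem IsBent.kerCount_sq {f : V d → Bool} (h : IsBent f) {ξ : V d} (hξ : ξ ≠ 0) :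
    (2 * (wt f : ℤ) - 4 * (kerCount f ξ : ℤ)) ^ 2 = 2 ^ d := by
  have := h.2 ξ
  rwa [walsh_eq_kerCount, if_neg hξ, zero_add] at this

/-- **The dual bent function**: if `f` is bent then `W_f(ξ) = 2^{d/2} · (−1)^{f̃ ξ}` for a (unique)
Boolean function `f̃`, the DUAL of `f`. -/
theorem IsBent.exists_dual {f : V d → Bool} (h : IsBent f) :
    ∃ fd : V d → Bool, ∀ ξ, walsh f ξ = 2 ^ (d / 2) * sgn fd ξ := by
  obtain ⟨⟨k, hk⟩, hw⟩ := h
  have hd : d / 2 = k := by omega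
  refine ⟨fun ξ => decide (walsh f ξ = -(2 : ℤ) ^ (d / 2)), fun ξ => ?_⟩
  have hsq : walsh f ξ ^ 2 = ((2 : ℤ) ^ (d / 2)) ^ 2 := by
    rw [hw ξ, ← pow_mul, hd]; congr 1; omega
  rcases sq_eq_sq_iff_eq_or_eq_neg.1 hsq with hpos | hneg
  · simp [sgn, hpos]
  · simp [sgn, hneg]

/-- Parseval forces `d` even as soon as all `W_f(ξ)²` are equal: recorded as the converse sanity
statement «flat spectrum ⇒ the common value is `2^d`». -/
theorem walsh_sq_const_eq {f : V d → Bool} {c : ℤ} (hc : ∀ ξ, walsh f ξ ^ 2 = c) : c = 2 ^ d := by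
  have h := sum_walsh_sq f
  simp_rw [hc] at h
  rw [sum_const, card_univ, card_V, nsmul_eq_mul] at h
  push_cast at h
  have hpos : (0 : ℤ) < 2 ^ d := by positivity
  exact mul_left_cancel₀ hpos.ne' h

/-- Sanity (the definitions compute): the inner product `x₀·x₁` on `𝔽₂²` is bent. -/
example : IsBent (fun x : V 2 => decide (x 0 * x 1 = 1)) := by
  refine ⟨⟨1, rfl⟩, ?_⟩
  unfold walsh sgn chi pair
  decide

/-! ### 2. Autocorrelation, balanced derivatives, duality -/

/-- **Bent functions have vanishing autocorrelation** off the origin. -/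
theorem IsBent.autocorr {f : V d → Bool} (h : IsBent f) {v : V d} (hv : v ≠ 0) :
    ∑ x, sgn f x * sgn f (x + v) = 0 := by
  have h1 := sum_walsh_sq_chi f v
  simp_rw [h.2] at h1
  rw [← mul_sum, sum_chi_left, if_neg hv, mul_zero] at h1
  have hpos : (2 : ℤ) ^ d ≠ 0 := by positivity
  exact (mul_eq_zero.1 h1.symm).resolve_left hpos

/-- **Balanced derivatives** (census (c2)): for bent `f` and `v ≠ 0`, `f(x) = f(x+v)` for exactly half of
the points. -/
theorem IsBent.two_mul_card_shift_eq {f : V d → Bool} (h : IsBent f) {v : V d} (hv : v ≠ 0) :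
    2 * (((univ : Finset (V d)).filter fun x => f x = f (x + v)).card : ℤ) = 2 ^ d := by
  have h1 := h.autocorr hv
  have h2 : ∀ x, sgn f x * sgn f (x + v) = 2 * (if f x = f (x + v) then 1 else 0) - 1 := by
    intro x; unfold sgn
    cases f x <;> cases f (x + v) <;> simp
  simp_rw [h2, sum_sub_distrib, ← mul_sum] at h1
  rw [sum_boole, sum_const, card_univ, card_V, nsmul_eq_mul, mul_one] at h1
  push_cast at h1
  linarith

/-- **Duality** (census (c4)): the dual `fd` of a bent `f` (`W_f = 2^{d/2}·(−1)^{fd}`) has Walsh transform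
`W_{fd}(x) = 2^{d/2}·(−1)^{f x}`; in particular it is bent with dual `f`. -/
theorem IsBent.walsh_dual {f fd : V d → Bool} (h : IsBent f)
    (hfd : ∀ ξ, walsh f ξ = 2 ^ (d / 2) * sgn fd ξ) (x : V d) :
    walsh fd x = 2 ^ (d / 2) * sgn f x := by
  obtain ⟨⟨k, hk⟩, -⟩ := h
  have hd : (2 : ℤ) ^ d = 2 ^ (d / 2) * 2 ^ (d / 2) := by
    rw [← pow_add]; congr 1; omega
  have h1 : (2 : ℤ) ^ (d / 2) * walsh fd x = 2 ^ (d / 2) * (2 ^ (d / 2) * sgn f x) := by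
    have h2 : ∑ ξ, walsh f ξ * chi ξ x = 2 ^ (d / 2) * walsh fd x := by
      simp_rw [hfd]
      unfold walsh
      rw [mul_sum]
      exact sum_congr rfl fun ξ _ => by rw [chi_comm ξ x]; ring
    rw [← h2, sum_walsh_chi, hd, mul_assoc]
  have hpos : (2 : ℤ) ^ (d / 2) ≠ 0 := by positivity
  exact mul_left_cancel₀ hpos h1

/-- The dual of a bent function is bent. -/
theorem IsBent.dual_isBent {f fd : V d → Bool} (h : IsBent f)
    (hfd : ∀ ξ, walsh f ξ = 2 ^ (d / 2) * sgn fd ξ) : IsBent fd := by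
  refine ⟨h.1, fun x => ?_⟩
  obtain ⟨k, hk⟩ := h.1
  rw [h.walsh_dual hfd x, mul_pow, ← pow_mul, sq, sgn_mul_self, mul_one]
  congr 1; omega

/-- **Exchange of invariants under duality** (census (c5)), first half: the weight of `f` is read off the
dual's value at `0`: `2^d − 2·wt f = 2^{d/2}·(−1)^{fd 0}`. -/
theorem IsBent.wt_eq_dual_zero {f fd : V d → Bool} (hfd : ∀ ξ, walsh f ξ = 2 ^ (d / 2) * sgn fd ξ) :
    (2 : ℤ) ^ d - 2 * (wt f : ℤ) = 2 ^ (d / 2) * sgn fd 0 := by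
  rw [← walsh_zero, hfd 0]

/-- **Exchange of invariants under duality**, second half: the dual's weight is read off `f 0`:
`2^d − 2·wt fd = 2^{d/2}·(−1)^{f 0}`.  Hence for bent `f, g`: `wt f = wt g ∧ f 0 = g 0` iff
`fd 0 = gd 0 ∧ wt fd = wt gd` — the hypothesis of (B) is self-dual. -/
theorem IsBent.dual_wt_eq_zero {f fd : V d → Bool} (h : IsBent f)
    (hfd : ∀ ξ, walsh f ξ = 2 ^ (d / 2) * sgn fd ξ) :
    (2 : ℤ) ^ d - 2 * (wt fd : ℤ) = 2 ^ (d / 2) * sgn f 0 := by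
  rw [← walsh_zero, h.walsh_dual hfd 0]

/-! ### 3. The typed targets (B) and (I′) -/

/-- `f` and `g` are GL-equivalent: `g = f ∘ A` for an additive bijection `A` of `𝔽₂^d`. -/
def GLEquiv (f g : V d → Bool) : Prop :=
  ∃ A : V d → V d, Function.Bijective A ∧ (∀ x y, A (x + y) = A x + A y) ∧ ∀ x, g x = f (A x)

/-- GL-equivalence is reflexive. -/
theorem glEquiv_refl (f : V d → Bool) : GLEquiv f f :=
  ⟨id, Function.bijective_id, fun _ _ => rfl, fun _ => rfl⟩

/-- (B) «bent ⇒ C³-blind» (census g10 (B); critic 03:51:31Z (a), 04:14:45Z R3): bent functions of one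
dimension with equal weight and equal value at `0` have `C³`-equivalent affine Cayley structures.
Kernel plan: NODE-g8 §5(a) (Duplicator strategy space (p1)–(p3) + counting lemmas (c1)–(c5) of §3). -/
@[conjecture]
def BentCThreeBlind : Prop :=
  ∀ (d : ℕ) (f g : V d → Bool), IsBent f → IsBent g → wt f = wt g → f 0 = g 0 →
    AffinePebbleEquiv 3 d (grpMat f) (grpMat g)

/-- (I′) «C⁴ decides GL-equivalence on bent Cayley structures» (emerging NO-GO conjecture of the
census, g10 (I′); evidence d = 6 all classes, d = 8 twins, D = 10 same-Π doublings; critic R4: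
EVIDENCE-LEVEL).  Its truth would close the bent/Maiorana–McFarland habitat for P′ at `k′ = 4`. -/
@[conjecture]
def CFourDecidesGLOnBent : Prop :=
  ∀ (d : ℕ) (f g : V d → Bool), IsBent f → IsBent g →
    AffinePebbleEquiv 4 d (grpMat f) (grpMat g) → GLEquiv f g

/-- Sanity: the hypotheses `wt f = wt g` of (B) is NECESSARY for its conclusion
(`wt_eq_of_pebbleEquiv_three`); so (B) asserts that, on bent functions of one dimension, weight and the
value at `0` are the ONLY `C³`-invariants. -/
theorem bentCThreeBlind_hyp_necessary (f g : V d → Bool)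
    (h : AffinePebbleEquiv 3 d (grpMat f) (grpMat g)) : wt f = wt g :=
  wt_eq_of_pebbleEquiv_three f g h

end Summit.ValiantsHypothesis.ValiantsHypothesis.Theorems.SymmetryDialBent
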